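import Mathlib
import Summits.ResolutionOfSingularities.ResolutionOfSingularities.Theorems.RadicialJungCleanModelsCleanPermissibleCurveCriterion
import HarnessLib

/-!
# Route `RadicialJung`, crux `CleanModels` (stmt-ResolutionOfSingularities-15917), line `Sketch` rev 35, stub 6 `stub_cleanProp44` (X44c):
# CLEAN-PERMISSIBILITY OF NEAR LINES, I — the local dictionary at a point of the exceptional divisor («births»)

Seat decomp-res-hand-2 g18 (structural hand), the missing lemma (ii) of hand-2 g17's census of the Phase II residual (R1ᵐⁱⁿ)
(`Cruxes/CleanModels/Lines/Sketch-memo-hand2-g17-stubs-5-7.md` §2 (a)): WHERE on a near line is the transform of a clean line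
clean-permissible?  After the blowing up of a closed point `x` at which the line is clean of form (1), `u · ∏_{k<m} t_k^{a_k}`, the transform at a
point `x'` of the exceptional divisor `E_x` (chart `t_i`, exceptional parameter `e = t_i`) reads `v · e^A · ∏_{k ∈ S} s_k^{a_k}` with `v` a unit,
`A = Σ_k a_k`, `S` the set of clean sides `V(t_k)` whose strict transforms `V(s_k)` pass through `x'`, and `(e, (s_k)_{k ∈ S})` part of a regular
system of parameters of `𝒪_{x'}` (the computation inside ✓ `looseCleanForm_centreChart_of_monomial`, `…CentreBlowupChart.lean`); a near line — more
generally any regular curve germ inside `E_x` through `x'` — has stalk ideal `N = (e, z)` with `(e, z)` part of a regular system of parameters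
([CoP1] Lemma 4.3 (5); ✓ `CP2008Prop44.stalkIdeal_vanishingIdeal_closure_eq_span_pair_of_adapted`).  This file decides `CleanPermissibleAt` for such
`N` from that normal form, in a regular local ring `R` of dimension `3` read in a field `F` of characteristic `p` (pure local algebra, def-free):

* `exists_rep_of_rep_eq_mul_pow`, `exists_rep_of_rep_eq_mul_pow_sub` — bookkeeping: a `p`-th power FACTOR of a non-trivial representative
  can be removed (and a `p`-th power subtracted): `Σ c_j^p G^j = Y d^p` ⟹ some non-trivial representative equals `Y - r^p`.
* `cleanPermissibleAt_of_rep_mem_centre` — a representative which is a minimal generator of the curve ideal (`r ∈ N ∖ 𝔪²`) makes `N`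
  clean-permissible (companion of ✓ `cleanPermissibleAt_of_rep_transversal`, the case `r ∈ 𝔪 ∖ (N + 𝔪²)`).
* CHARGED CASES (some exponent in sight prime to `p`; memo 4e §2.4 (B1) «no births in charged planes / through a side»):
  `cleanPermissibleAt_exceptional_of_not_dvd` (no side through `x'`, `p ∤ A`: EVERY `N = (e, z)`), `cleanPermissibleAt_exceptional_of_side_mem`
  (a side `s` with `s ∈ N`, i.e. `N = (e, s)` is the side), `cleanPermissibleAt_exceptional_of_side_transversal` (a side `s` transversal to `N`:
  `(e, z, s)` a regular system), `cleanPermissibleAt_exceptional_of_two_sides` (a corner, `N` one of the two axes).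
* THE UNCHARGED CASE `p ∣ A`, no side (memo 4e §2.4 (B2)/(B5)): after removing `e^A = (e^{A/p})^p` the representative is the UNIT `v`, and
  `N` is clean-permissible as soon as `x'` is NOT A BIRTH of `N`: `cleanPermissibleAt_of_unit_rep_of_forall` (`v̄ ∉ κ(x')^p`, form (2)),
  `cleanPermissibleAt_of_unit_rep_of_transversal` (some `v - c'^p ∈ 𝔪 ∖ (N + 𝔪²)`), `cleanPermissibleAt_of_unit_rep_of_mem_centre` (some
  `v - c'^p ∈ N ∖ 𝔪²`), packaged as `cleanPermissibleAt_of_unit_rep`.  What is left out is exactly the birth configuration «`v̄ ∈ κ(x')^p` and every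
  `v - c'^p ∈ 𝔪` lies in `(N + 𝔪²) ∖ N`» (the `W`-tangency points of memo 4e §2.4; NOT clean-permissible in general, e.g. the tangent line of
  `T₁T₂ = βγ` at `(β, γ)` for `G = t₀ t₁ t₂`, `p = 3`, by ✓ `not_cleanPermissibleAt_of_derivations`).

Honest framing: OURS, elementary; a TOOL for the (R1ᵐⁱⁿ)/(R3ᵐⁱⁿ′) provers (the scheme-level normal form is the companion file).  Nothing here proves
X44c, any case of `CleanModels`, or resolution of singularities in characteristic `p`.
Setting only: [cite: Piltant2013, §2 Axiom 4] [cite: CossartPiltant2008, Lemma 4.3 (5)] [cite: Matsumura1987, Thm. 14.2].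
-/

noncomputable section

set_option linter.dupNamespace false -- mandated namespace of this single-conjunct summit

open IsLocalRing
open Literature.AlgebraicGeometry.Resolution

namespace Summit.ResolutionOfSingularities.ResolutionOfSingularities.Theorems.RadicialJung.CleanModels

universe u

/-! ## §0 Representatives: removing a `p`-th power factor -/

/-- **A `p`-th power factor of a non-trivial representative can be removed**: if `Σ c_j^p G^j = Y · d^p` with `d ≠ 0`, then `Y` itself is a
non-trivial representative of the line of `G` (coefficients `c_j / d`). [folklore] -/
theorem exists_rep_of_rep_eq_mul_pow {F : Type*} [Field F] (p : ℕ) [hp : Fact p.Prime] [CharP F p] (G : F) (cc : Fin p → F)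
    (hcc : ∃ j : Fin p, (j : ℕ) ≠ 0 ∧ cc j ≠ 0) {Y d : F} (hd : d ≠ 0)
    (hX : (∑ j : Fin p, cc j ^ p * G ^ (j : ℕ)) = Y * d ^ p) :
    ∃ cc' : Fin p → F, (∃ j : Fin p, (j : ℕ) ≠ 0 ∧ cc' j ≠ 0) ∧ (∑ j : Fin p, cc' j ^ p * G ^ (j : ℕ)) = Y := by
  obtain ⟨cc', hcc', hsum⟩ := exists_rep_twist p G cc hcc d⁻¹ 0 (inv_ne_zero hd)
  refine ⟨cc', hcc', ?_⟩
  rw [hsum, hX, zero_pow hp.out.ne_zero, sub_zero, inv_pow, mul_comm Y, ← mul_assoc, inv_mul_cancel₀ (pow_ne_zero _ hd), one_mul]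

/-- Same, subtracting moreover a `p`-th power: `Σ c_j^p G^j = Y · d^p`, `d ≠ 0` ⟹ `Y - r^p` is a non-trivial representative. [folklore] -/
theorem exists_rep_of_rep_eq_mul_pow_sub {F : Type*} [Field F] (p : ℕ) [hp : Fact p.Prime] [CharP F p] (G : F) (cc : Fin p → F)
    (hcc : ∃ j : Fin p, (j : ℕ) ≠ 0 ∧ cc j ≠ 0) {Y d : F} (hd : d ≠ 0)
    (hX : (∑ j : Fin p, cc j ^ p * G ^ (j : ℕ)) = Y * d ^ p) (r : F) :
    ∃ cc' : Fin p → F, (∃ j : Fin p, (j : ℕ) ≠ 0 ∧ cc' j ≠ 0) ∧ (∑ j : Fin p, cc' j ^ p * G ^ (j : ℕ)) = Y - r ^ p := by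
  obtain ⟨cc', hcc', hsum⟩ := exists_rep_twist p G cc hcc d⁻¹ r (inv_ne_zero hd)
  refine ⟨cc', hcc', ?_⟩
  rw [hsum, hX, inv_pow, mul_comm Y, ← mul_assoc, inv_mul_cancel₀ (pow_ne_zero _ hd), one_mul]

/-! ## §1 Plumbing on spans of three parameters -/

section Spans

variable {R : Type u} [CommRing R] [IsLocalRing R]

/-- Members of a generating triple of `𝔪` lie in `𝔪`. [folklore] -/
private theorem mem_of_span_triple_eq {a b c : R} (h : Ideal.span ({a, b, c} : Set R) = maximalIdeal R) :
    a ∈ maximalIdeal R ∧ b ∈ maximalIdeal R ∧ c ∈ maximalIdeal R :=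
  ⟨h ▸ Ideal.subset_span (by simp), h ▸ Ideal.subset_span (by simp), h ▸ Ideal.subset_span (by simp)⟩

omit [IsLocalRing R] in
/-- Replacing the first generator of a pair by `r = α a + β b` with `α` a unit does not change the span. [folklore] -/
private theorem span_pair_eq_of_unit_left {a b r α β : R} (hα : IsUnit α) (hr : r = α * a + β * b) :
    Ideal.span ({r, b} : Set R) = Ideal.span {a, b} := by
  obtain ⟨v, rfl⟩ := hα
  apply le_antisymm
  · rw [Ideal.span_le, Set.insert_subset_iff, Set.singleton_subset_iff]
    refine ⟨?_, Ideal.subset_span (by simp)⟩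
    rw [SetLike.mem_coe, hr]
    exact Ideal.add_mem _ (Ideal.mul_mem_left _ _ (Ideal.subset_span (by simp))) (Ideal.mul_mem_left _ _ (Ideal.subset_span (by simp)))
  · rw [Ideal.span_le, Set.insert_subset_iff, Set.singleton_subset_iff]
    refine ⟨?_, Ideal.subset_span (by simp)⟩
    have ha : a = ↑v⁻¹ * (r - β * b) := by
      rw [hr, add_sub_cancel_right, ← mul_assoc, Units.inv_mul, one_mul]
    rw [SetLike.mem_coe, ha]
    exact Ideal.mul_mem_left _ _ (Ideal.sub_mem _ (Ideal.subset_span (by simp)) (Ideal.mul_mem_left _ _ (Ideal.subset_span (by simp))))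

omit [IsLocalRing R] in
/-- Replacing the first generator of a triple by `r = α a + β b` with `α` a unit does not change the span. [folklore] -/
private theorem span_triple_eq_of_unit_left {a b c r α β : R} (hα : IsUnit α) (hr : r = α * a + β * b) :
    Ideal.span ({r, b, c} : Set R) = Ideal.span {a, b, c} := by
  have h2 := span_pair_eq_of_unit_left (a := a) (b := b) hα hr
  have key : ∀ (x y : R) (z : R), Ideal.span ({x, y, z} : Set R) = Ideal.span {x, y} ⊔ Ideal.span {z} := by
    intro x y z
    have hset : ({x, y, z} : Set R) = {x, y} ∪ {z} := by
      ext b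
      simp only [Set.mem_insert_iff, Set.mem_singleton_iff, Set.mem_union]
      tauto
    rw [hset, Ideal.span_union]
  rw [key, key, h2]

end Spans

/-! ## §2 A representative which is a minimal generator of the curve ideal -/

/-- **A representative in `N ∖ 𝔪²` makes the curve clean-permissible.**  `R` regular local of dimension `3` with regular system of parameters
`(c₁, c₂, t)`, `N = (c₁, c₂)`; if some non-trivial representative `Σ c_j^p G^j` equals `f r` with `r ∈ N ∖ 𝔪²`, then the line of `G` is
clean-permissible at `R` for `N`: writing `r = α c₁ + β c₂`, one of `α, β` is a unit, so `(r, c₂; t)` or `(c₁, r; t)` is an adapted regular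
system of parameters in which the representative is the monomial `r¹`.  (Companion of ✓ `cleanPermissibleAt_of_rep_transversal`.)
[cite: Piltant2013, §2 Axiom 4] [cite: Matsumura1987, Thm. 14.2] -/
theorem cleanPermissibleAt_of_rep_mem_centre {R : Type u} {F : Type u} [CommRing R] [IsLocalRing R] [Field F] {p : ℕ} [hp : Fact p.Prime]
    (f : R →+* F) (hR : IsRegularLocalRing R) (hdim : ringKrullDim R = 3) {c₁ c₂ t : R}
    (h : Ideal.span ({c₁, c₂, t} : Set R) = maximalIdeal R) {G : F} (cc : Fin p → F) (hcc : ∃ j : Fin p, (j : ℕ) ≠ 0 ∧ cc j ≠ 0)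
    {r : R} (hrep : (∑ j : Fin p, cc j ^ p * G ^ (j : ℕ)) = f r) (hrN : r ∈ Ideal.span ({c₁, c₂} : Set R))
    (hr2 : r ∉ maximalIdeal R ^ 2) :
    CleanPermissibleAt p f G (Ideal.span ({c₁, c₂} : Set R)) := by
  obtain ⟨hc₁m, hc₂m, htm⟩ := mem_of_span_triple_eq h
  obtain ⟨α, β, hr⟩ := Ideal.mem_span_pair.mp hrN
  have hp1 : ¬ p ∣ 1 := hp.out.not_dvd_one
  by_cases hα : IsUnit α
  · -- `(r, c₂; t)`
    have hr' : r = α * c₁ + β * c₂ := hr.symm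
    have hN : Ideal.span ({r, c₂} : Set R) = Ideal.span {c₁, c₂} := span_pair_eq_of_unit_left hα hr'
    have h𝔪 : Ideal.span ({r, c₂, t} : Set R) = maximalIdeal R := by rw [span_triple_eq_of_unit_left hα hr', h]
    rw [← hN]
    exact cleanPermissibleAt_of_monomial_vec3 f hR hdim h𝔪 cc hcc isUnit_one 1 0 0 (Or.inl hp1) (by rw [hrep]; simp)
  · -- then `β` is a unit (else `r ∈ 𝔪²`), and `(c₁, r; t)`
    have hβ : IsUnit β := by
      by_contra hβ
      apply hr2
      rw [← hr, pow_two]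
      exact Ideal.add_mem _ (Ideal.mul_mem_mul ((mem_maximalIdeal _).mpr hα) hc₁m) (Ideal.mul_mem_mul ((mem_maximalIdeal _).mpr hβ) hc₂m)
    have hr' : r = β * c₂ + α * c₁ := by rw [← hr, add_comm]
    have hN : Ideal.span ({c₁, r} : Set R) = Ideal.span {c₁, c₂} := by
      rw [Ideal.span_pair_comm, span_pair_eq_of_unit_left hβ hr', Ideal.span_pair_comm]
    have h𝔪 : Ideal.span ({c₁, r, t} : Set R) = maximalIdeal R := by
      have hswap : ∀ x y z : R, ({x, y, z} : Set R) = {y, x, z} := fun x y z => Set.insert_comm x y {z}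
      rw [hswap, span_triple_eq_of_unit_left hβ hr', hswap, h]
    rw [← hN]
    exact cleanPermissibleAt_of_monomial_vec3 f hR hdim h𝔪 cc hcc isUnit_one 0 1 0 (Or.inr (Or.inl hp1)) (by rw [hrep]; simp)

/-! ## §3 Charged cases: an exponent in sight is prime to `p` (no births) -/

/-- **Charged exceptional plane, no side through the point**: the transform is `v · e^A` with `p ∤ A`; then EVERY regular curve germ `N = (e, z)` inside
the exceptional divisor through the point (`(e, z, z')` a regular system of parameters) is clean-permissible (memo 4e §2.4 (B1)).
[cite: Piltant2013, §2 Axiom 4] -/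
theorem cleanPermissibleAt_exceptional_of_not_dvd {R : Type u} {F : Type u} [CommRing R] [IsLocalRing R] [Field F] {p : ℕ} [Fact p.Prime]
    (f : R →+* F) (hR : IsRegularLocalRing R) (hdim : ringKrullDim R = 3) {e z z' : R}
    (h : Ideal.span ({e, z, z'} : Set R) = maximalIdeal R) {G : F} (cc : Fin p → F) (hcc : ∃ j : Fin p, (j : ℕ) ≠ 0 ∧ cc j ≠ 0)
    {v : R} (hv : IsUnit v) {A : ℕ} (hA : ¬ p ∣ A) (hrep : (∑ j : Fin p, cc j ^ p * G ^ (j : ℕ)) = f (v * e ^ A)) :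
    CleanPermissibleAt p f G (Ideal.span ({e, z} : Set R)) :=
  cleanPermissibleAt_of_monomial_vec3 f hR hdim h cc hcc hv A 0 0 (Or.inl hA) (by rw [hrep]; simp)

/-- **A clean side contained in the curve** (`N = (e, s)` is the trace of the side `V(s)` on the exceptional divisor): the transform
`v · e^A · s^a` with `p ∤ A` or `p ∤ a` is clean-permissible for `N`. [cite: Piltant2013, §2 Axiom 4] -/
theorem cleanPermissibleAt_exceptional_of_side_mem {R : Type u} {F : Type u} [CommRing R] [IsLocalRing R] [Field F] {p : ℕ} [Fact p.Prime]
    (f : R →+* F) (hR : IsRegularLocalRing R) (hdim : ringKrullDim R = 3) {e s t : R}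
    (h : Ideal.span ({e, s, t} : Set R) = maximalIdeal R) {G : F} (cc : Fin p → F) (hcc : ∃ j : Fin p, (j : ℕ) ≠ 0 ∧ cc j ≠ 0)
    {v : R} (hv : IsUnit v) {A a : ℕ} (hAa : ¬ p ∣ A ∨ ¬ p ∣ a)
    (hrep : (∑ j : Fin p, cc j ^ p * G ^ (j : ℕ)) = f (v * e ^ A * s ^ a)) :
    CleanPermissibleAt p f G (Ideal.span ({e, s} : Set R)) :=
  cleanPermissibleAt_of_monomial_vec3 f hR hdim h cc hcc hv A a 0
    (by rcases hAa with h1 | h1 <;> simp [h1]) (by rw [hrep]; simp)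

/-- **A clean side transversal to the curve** (`N = (e, z)`, the side `V(s)` with `(e, z, s)` a regular system of parameters): the transform
`v · e^A · s^a` with `p ∤ A` or `p ∤ a` is clean-permissible for `N`. [cite: Piltant2013, §2 Axiom 4] -/
theorem cleanPermissibleAt_exceptional_of_side_transversal {R : Type u} {F : Type u} [CommRing R] [IsLocalRing R] [Field F] {p : ℕ}
    [Fact p.Prime] (f : R →+* F) (hR : IsRegularLocalRing R) (hdim : ringKrullDim R = 3) {e z s : R}
    (h : Ideal.span ({e, z, s} : Set R) = maximalIdeal R) {G : F} (cc : Fin p → F) (hcc : ∃ j : Fin p, (j : ℕ) ≠ 0 ∧ cc j ≠ 0)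
    {v : R} (hv : IsUnit v) {A a : ℕ} (hAa : ¬ p ∣ A ∨ ¬ p ∣ a)
    (hrep : (∑ j : Fin p, cc j ^ p * G ^ (j : ℕ)) = f (v * e ^ A * s ^ a)) :
    CleanPermissibleAt p f G (Ideal.span ({e, z} : Set R)) :=
  cleanPermissibleAt_of_monomial_vec3 f hR hdim h cc hcc hv A 0 a
    (by rcases hAa with h1 | h1 <;> simp [h1]) (by rw [hrep]; simp)

/-- **A corner, the curve being an axis** (`N = (e, s₁)`, the sides `V(s₁)`, `V(s₂)` with `(e, s₁, s₂)` a regular system of parameters): the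
transform `v · e^A · s₁^{a₁} · s₂^{a₂}` with one of `A, a₁, a₂` prime to `p` is clean-permissible for `N` (✓ `cleanPermissibleAt_axis_cornerWitness`
is the instance `A = 0`; the DIAGONAL through a corner is not clean-permissible, ✓ `not_cleanPermissibleAt_diagonal_cornerWitness`).
[cite: Piltant2013, §2 Axiom 4] -/
theorem cleanPermissibleAt_exceptional_of_two_sides {R : Type u} {F : Type u} [CommRing R] [IsLocalRing R] [Field F] {p : ℕ}
    [Fact p.Prime] (f : R →+* F) (hR : IsRegularLocalRing R) (hdim : ringKrullDim R = 3) {e s₁ s₂ : R}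
    (h : Ideal.span ({e, s₁, s₂} : Set R) = maximalIdeal R) {G : F} (cc : Fin p → F) (hcc : ∃ j : Fin p, (j : ℕ) ≠ 0 ∧ cc j ≠ 0)
    {v : R} (hv : IsUnit v) {A a₁ a₂ : ℕ} (hAa : ¬ p ∣ A ∨ ¬ p ∣ a₁ ∨ ¬ p ∣ a₂)
    (hrep : (∑ j : Fin p, cc j ^ p * G ^ (j : ℕ)) = f (v * e ^ A * s₁ ^ a₁ * s₂ ^ a₂)) :
    CleanPermissibleAt p f G (Ideal.span ({e, s₁} : Set R)) :=
  cleanPermissibleAt_of_monomial_vec3 f hR hdim h cc hcc hv A a₁ a₂ hAa hrep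

/-! ## §4 The uncharged case: a unit representative (births dictionary) -/

/-- **Unit representative whose residue is not a `p`-th power** (form (2)): if `Σ c_j^p G^j = f(v) · d^p` with `v` a unit of `R`, `d ≠ 0`, and
`v - c'^p ∉ 𝔪` for every `c'`, then the line is clean-permissible for EVERY curve ideal `N = (c₁, c₂)` cut out by two of three regular parameters.
[cite: Piltant2013, §2 Axiom 4] -/
theorem cleanPermissibleAt_of_unit_rep_of_forall {R : Type u} {F : Type u} [CommRing R] [IsLocalRing R] [Field F] {p : ℕ}
    [hp : Fact p.Prime] [CharP F p] (f : R →+* F) (hR : IsRegularLocalRing R) (hdim : ringKrullDim R = 3) {c₁ c₂ t : R}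
    (h : Ideal.span ({c₁, c₂, t} : Set R) = maximalIdeal R) {G : F} (cc : Fin p → F) (hcc : ∃ j : Fin p, (j : ℕ) ≠ 0 ∧ cc j ≠ 0)
    {v : R} (hv : IsUnit v) {d : F} (hd : d ≠ 0) (hrep : (∑ j : Fin p, cc j ^ p * G ^ (j : ℕ)) = f v * d ^ p)
    (hres : ∀ c' : R, v - c' ^ p ∉ maximalIdeal R) :
    CleanPermissibleAt p f G (Ideal.span ({c₁, c₂} : Set R)) := by
  classical
  obtain ⟨cc', hcc', hsum⟩ := exists_rep_of_rep_eq_mul_pow p G cc hcc hd hrep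
  refine ⟨hR, 2, 1, ![c₁, c₂], ![t], ?_, by rw [hdim]; norm_cast, ?_, cc', hcc', Or.inr ⟨v, hv, hsum, hres⟩⟩
  · have happ : Fin.append ![c₁, c₂] ![t] = ![c₁, c₂, t] := by
      ext i; fin_cases i <;> rfl
    have hr : Set.range ![c₁, c₂, t] = {c₁, c₂, t} := by
      ext a
      simp only [Set.mem_range, Set.mem_insert_iff, Set.mem_singleton_iff]
      constructor
      · rintro ⟨i, rfl⟩
        fin_cases i <;> simp
      · rintro (rfl | rfl | rfl)
        exacts [⟨0, rfl⟩, ⟨1, rfl⟩, ⟨2, rfl⟩]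
    rw [happ, hr, h]
  · congr 1
    ext a
    simp only [Set.mem_range, Set.mem_insert_iff, Set.mem_singleton_iff]
    constructor
    · rintro ⟨i, rfl⟩
      fin_cases i <;> simp
    · rintro (rfl | rfl)
      exacts [⟨0, rfl⟩, ⟨1, rfl⟩]

/-- **Unit representative with a TRANSVERSAL `p`-th power residue**: `Σ c_j^p G^j = f(v) · d^p`, `v` a unit, and some `v - c'^p ∈ 𝔪 ∖ (N + 𝔪²)`;
then the line is clean-permissible for `N = (c₁, c₂)` (the representative `f(v - c'^p)` is a transversal parameter,
✓ `cleanPermissibleAt_of_rep_transversal`). [cite: Piltant2013, §2 Axiom 4] -/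
theorem cleanPermissibleAt_of_unit_rep_of_transversal {R : Type u} {F : Type u} [CommRing R] [IsLocalRing R] [Field F] {p : ℕ}
    [hp : Fact p.Prime] [CharP F p] (f : R →+* F) (hR : IsRegularLocalRing R) (hdim : ringKrullDim R = 3) {c₁ c₂ t : R}
    (h : Ideal.span ({c₁, c₂, t} : Set R) = maximalIdeal R) {G : F} (cc : Fin p → F) (hcc : ∃ j : Fin p, (j : ℕ) ≠ 0 ∧ cc j ≠ 0)
    {v : R} {d : F} (hd : d ≠ 0) (hrep : (∑ j : Fin p, cc j ^ p * G ^ (j : ℕ)) = f v * d ^ p)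
    {c' : R} (hc'm : v - c' ^ p ∈ maximalIdeal R) (hc'N : v - c' ^ p ∉ Ideal.span ({c₁, c₂} : Set R) ⊔ maximalIdeal R ^ 2) :
    CleanPermissibleAt p f G (Ideal.span ({c₁, c₂} : Set R)) := by
  obtain ⟨cc', hcc', hsum⟩ := exists_rep_of_rep_eq_mul_pow_sub p G cc hcc hd hrep (f c')
  have hsum' : (∑ j : Fin p, cc' j ^ p * G ^ (j : ℕ)) = f (v - c' ^ p) := by rw [hsum, map_sub, map_pow]
  exact cleanPermissibleAt_of_rep_transversal f hR hdim h cc' hcc' hsum' hc'm hc'N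

/-- **Unit representative with a `p`-th power residue CUT OUT BY THE CURVE**: `Σ c_j^p G^j = f(v) · d^p`, and some `v - c'^p ∈ N ∖ 𝔪²`; then the
line is clean-permissible for `N = (c₁, c₂)` (`cleanPermissibleAt_of_rep_mem_centre`; e.g. the level line `{T₁ = β}` of `v̄ = ū T₁^{a₁}`).
[cite: Piltant2013, §2 Axiom 4] -/
theorem cleanPermissibleAt_of_unit_rep_of_mem_centre {R : Type u} {F : Type u} [CommRing R] [IsLocalRing R] [Field F] {p : ℕ}
    [hp : Fact p.Prime] [CharP F p] (f : R →+* F) (hR : IsRegularLocalRing R) (hdim : ringKrullDim R = 3) {c₁ c₂ t : R}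
    (h : Ideal.span ({c₁, c₂, t} : Set R) = maximalIdeal R) {G : F} (cc : Fin p → F) (hcc : ∃ j : Fin p, (j : ℕ) ≠ 0 ∧ cc j ≠ 0)
    {v : R} {d : F} (hd : d ≠ 0) (hrep : (∑ j : Fin p, cc j ^ p * G ^ (j : ℕ)) = f v * d ^ p)
    {c' : R} (hc'N : v - c' ^ p ∈ Ideal.span ({c₁, c₂} : Set R)) (hc'2 : v - c' ^ p ∉ maximalIdeal R ^ 2) :
    CleanPermissibleAt p f G (Ideal.span ({c₁, c₂} : Set R)) := by
  obtain ⟨cc', hcc', hsum⟩ := exists_rep_of_rep_eq_mul_pow_sub p G cc hcc hd hrep (f c')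
  have hsum' : (∑ j : Fin p, cc' j ^ p * G ^ (j : ℕ)) = f (v - c' ^ p) := by rw [hsum, map_sub, map_pow]
  exact cleanPermissibleAt_of_rep_mem_centre f hR hdim h cc' hcc' hsum' hc'N hc'2

/-- **THE BIRTHS DICTIONARY (uncharged exceptional plane, no side through the point).**  Let `R` be regular local of dimension `3` read in `F`
(characteristic `p`), `(c₁, c₂, t)` a regular system of parameters, `N = (c₁, c₂)`, and let a non-trivial representative of the line of `G` be
`f(v) · d^p` with `v` a unit and `d ≠ 0` (the transform `v · e^A`, `p ∣ A`).  If `x'` is NOT a birth of `N` — the residue of `v` is not a `p`-th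
power, or some `v - c'^p ∈ 𝔪` is transversal to `N` or a minimal generator of `N` — then the line is clean-permissible at `R` for `N`.
[cite: Piltant2013, §2 Axiom 4] [cite: CossartPiltant2008, Lemma 4.3 (5)] -/
theorem cleanPermissibleAt_of_unit_rep {R : Type u} {F : Type u} [CommRing R] [IsLocalRing R] [Field F] {p : ℕ}
    [hp : Fact p.Prime] [CharP F p] (f : R →+* F) (hR : IsRegularLocalRing R) (hdim : ringKrullDim R = 3) {c₁ c₂ t : R}
    (h : Ideal.span ({c₁, c₂, t} : Set R) = maximalIdeal R) {G : F} (cc : Fin p → F) (hcc : ∃ j : Fin p, (j : ℕ) ≠ 0 ∧ cc j ≠ 0)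
    {v : R} (hv : IsUnit v) {d : F} (hd : d ≠ 0) (hrep : (∑ j : Fin p, cc j ^ p * G ^ (j : ℕ)) = f v * d ^ p)
    (hbirth : (∀ c' : R, v - c' ^ p ∉ maximalIdeal R) ∨
      (∃ c' : R, v - c' ^ p ∈ maximalIdeal R ∧ v - c' ^ p ∉ Ideal.span ({c₁, c₂} : Set R) ⊔ maximalIdeal R ^ 2) ∨
      (∃ c' : R, v - c' ^ p ∈ Ideal.span ({c₁, c₂} : Set R) ∧ v - c' ^ p ∉ maximalIdeal R ^ 2)) :
    CleanPermissibleAt p f G (Ideal.span ({c₁, c₂} : Set R)) := by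
  rcases hbirth with hres | ⟨c', hc'm, hc'N⟩ | ⟨c', hc'N, hc'2⟩
  · exact cleanPermissibleAt_of_unit_rep_of_forall f hR hdim h cc hcc hv hd hrep hres
  · exact cleanPermissibleAt_of_unit_rep_of_transversal f hR hdim h cc hcc hd hrep hc'm hc'N
  · exact cleanPermissibleAt_of_unit_rep_of_mem_centre f hR hdim h cc hcc hd hrep hc'N hc'2

/-- **The uncharged transform `v · e^A`, `p ∣ A`, in the dictionary's currency**: `f(v · e^A) = f(v) · (f e^{A/p})^p`, so the theorems of §4 apply
with `d = f(e)^{A/p}` (non-zero as soon as `f e ≠ 0`). [folklore] -/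
theorem rep_eq_mul_pow_of_dvd {R : Type u} {F : Type u} [CommRing R] [Field F] {p : ℕ} (f : R →+* F) {G : F} (cc : Fin p → F)
    {v e : R} {A : ℕ} (hA : p ∣ A) (hrep : (∑ j : Fin p, cc j ^ p * G ^ (j : ℕ)) = f (v * e ^ A)) :
    (∑ j : Fin p, cc j ^ p * G ^ (j : ℕ)) = f v * (f e ^ (A / p)) ^ p := by
  rw [hrep, map_mul, map_pow, ← pow_mul, Nat.div_mul_cancel hA]

end Summit.ResolutionOfSingularities.ResolutionOfSingularities.Theorems.RadicialJung.CleanModels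

end
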